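import Mathlib
import Literature.NumberTheory.Automorphic.HilbertModularFormQExpansion
import Summits.Langlands.Langlands.Theorems.CapacityClassicalityHilbertIntegralOverconvergentIsCongruenceStubFourierCoeffMul
import Summits.Langlands.Langlands.Theorems.CapacityClassicalityHilbertIntegralOverconvergentIsCongruenceStubEncodedMul

/-!
# The cone class of functions on the tube domain is closed under products (stub S1)

Stub S1 `stub_coneClass_mul` of line Sketch-ideate-r1-k1 (section S, relations between encoded
`q`-expansions → relations between functions) for the crux `HilbertIntegralOverconvergentIsCongruence`
(stmt-Langlands-8485).  The CONE CLASS consists of the functions `f : ℍ → ℂ` that are holomorphic on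
`ℍ`, `𝓞 F`-periodic on `ℍ`, and whose Fourier coefficients `a_μ(f)` vanish at every dual-lattice index
`μ` off the cone `qIndexSet F` (`μ = 0` or `μ ≫ 0`).  We show the class is closed under products:
holomorphy is `DifferentiableOn.mul`, periodicity is pointwise, and for a dual-lattice index `ν` off the
cone the landed product formula `stub_fourierCoeff_mul` computes `a_ν(fg)` as a sum over any finite set
`T` of pairs of cone indices with sum `ν`; since the cone is closed under addition
(`emu_add_mem_qIndexSet`) there is no such pair, so `T = ∅` qualifies and `a_ν(fg) = 0`.
-/

set_option linter.dupNamespace false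

noncomputable section

namespace Summit.Langlands.Langlands.Theorems.HilbertIntegralOverconvergentIsCongruence

open MeasureTheory Complex NumberField
open Literature.NumberTheory.Automorphic Literature.NumberTheory.Automorphic.HilbertModular

/-- **Stub S1 — `stub_coneClass_mul`.** The class of holomorphic `𝓞 F`-periodic functions on `ℍ` with
CONE-SUPPORTED Fourier coefficients (`a_μ = 0` for `μ ∈ 𝔡⁻¹ ∖ qIndexSet`) is closed under products
(the cone is closed under `+`, so for `ν` off the cone the convolution `a_ν(fg) = ∑_{μ+μ'=ν} a_μ a_{μ'}`
of `stub_fourierCoeff_mul` is empty). [folklore] -/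
theorem stub_coneClass_mul (F : Type) [Field F] [NumberField F] [NumberField.IsTotallyReal F] (f g : Point F → ℂ)
    (hf : IsHolomorphicOn F f) (hg : IsHolomorphicOn F g)
    (hperf : ∀ (a : 𝓞 F) (z : Point F), z ∈ halfSpace F → f (fun σ ↦ z σ + ((σ (a : F) : ℝ) : ℂ)) = f z)
    (hperg : ∀ (a : 𝓞 F) (z : Point F), z ∈ halfSpace F → g (fun σ ↦ z σ + ((σ (a : F) : ℝ) : ℂ)) = g z)
    (hsf : ∀ μ : F, (∀ a : 𝓞 F, ∃ n : ℤ, Algebra.trace ℚ F (μ * a) = n) → μ ∉ qIndexSet F → fourierCoeff f μ = 0)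
    (hsg : ∀ μ : F, (∀ a : 𝓞 F, ∃ n : ℤ, Algebra.trace ℚ F (μ * a) = n) → μ ∉ qIndexSet F → fourierCoeff g μ = 0) :
    IsHolomorphicOn F (f * g) ∧
      (∀ (a : 𝓞 F) (z : Point F), z ∈ halfSpace F → (f * g) (fun σ ↦ z σ + ((σ (a : F) : ℝ) : ℂ)) = (f * g) z) ∧
      ∀ μ : F, (∀ a : 𝓞 F, ∃ n : ℤ, Algebra.trace ℚ F (μ * a) = n) → μ ∉ qIndexSet F → fourierCoeff (f * g) μ = 0 := by
  refine ⟨DifferentiableOn.mul hf hg, fun a z hz ↦ ?_, fun ν hν hνc ↦ ?_⟩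
  · -- periodicity is pointwise
    simp only [Pi.mul_apply, hperf a z hz, hperg a z hz]
  · -- off the cone the convolution of `stub_fourierCoeff_mul` is indexed by the empty set
    have hT : ∀ μ : F × F, μ ∈ (∅ : Finset (F × F)) ↔ μ.1 ∈ qIndexSet F ∧ μ.2 ∈ qIndexSet F ∧ μ.1 + μ.2 = ν := by
      intro μ
      refine ⟨fun h ↦ absurd h (Finset.notMem_empty μ), fun h ↦ ?_⟩
      exact absurd (h.2.2 ▸ emu_add_mem_qIndexSet h.1 h.2.1) hνc
    rw [stub_fourierCoeff_mul F f g hf hg hperf hperg hsf hsg ν hν ∅ hT, Finset.sum_empty]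

end Summit.Langlands.Langlands.Theorems.HilbertIntegralOverconvergentIsCongruence
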